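import Summits.HubbardSuperconductivity.HubbardSuperconductivity.Theorems.TwSeededEnsembleEquivalence.Negative.SeedTransfer
import Summits.HubbardSuperconductivity.HubbardSuperconductivity.Theorems.TwSeededEnsembleEquivalence.Negative.BetaMonotonicity
import Literature.MathematicalPhysics.QuantumLattice.HubbardFreeTorusGroundEnergy
import Literature.MathematicalPhysics.QuantumLattice.ApproximatingHamiltonianProofs
import Literature.MathematicalPhysics.QuantumLattice.HubbardGrandCanonicalDensity
import Literature.MathematicalPhysics.QuantumLattice.HubbardRingPerronFrobeniusProofs
import Literature.MathematicalPhysics.QuantumLattice.FermionLiebRobinson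

/-!
# Defect floor (Template H) for crux `TwSeededEnsembleEquivalence` (stmt-HubbardSuperconductivity-1698)

Negative-side support lemmas (refuter, cdisprove gen 4), all sorry-free and definition-free.

The crux bounds the DEFECT FUNCTIONAL of the seeded torus,
`D_L(β, μ; U, g) := minE(Hcan, szSector N_L 0)/L² + log Re Z(β, Hcan − μN̂)/(βL²) − μ N_L/L²`,
by the entropy allowance `log 4/β + ε`. Here we prove a FLOOR under `D_L`, uniformly in `L ≥ 3`:

* `log_partitionFn_free_torus_ge` — free thermal entropy is extensive:
  `log Re Z(β, K⁰_μ) ≥ −β E₀(K⁰_μ) + 2L² log(1 + e^{−βΞ})` whenever `|ε_L(k) − μ| ≤ Ξ` for all `k`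
  (exact BdG product formula of the tree at zero source + `(1 + cosh y)/2 = e^y (1 + e^{−y})²/4`);
* `log_partitionFn_seededGC_ge` — the same floor for the interacting seeded model, at the price `−βUL²`
  (drop the seed by Loewner monotonicity, `0 ≤ Σ n↑n↓ ≤ L²`);
* `seeded_defect_floor` — for `U, g ≥ 0`, `β > 0`, `|μ| ≤ 4` and every sector `K ≠ ⊥` of `N`-particle vectors:
  `(2/β) log(1 + e^{−8β}) − U − 32 g ≤ minE(Hcan, K)/L² + log Re Z(β, Hgc μ)/(βL²) − μN/L²`;
* `twSeededEnsembleEquivalence_false_of_allowance_lt` — ANY variant of the crux whose allowance `a(β)` dips below the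
  floor, `a(β₀) < (2/β₀) log(1 + e^{−8β₀})` at one `β₀ ≥ 1`, is FALSE (witness: `U, g → 0⁺`, `β = β₀`, `L ≥ 3`);
  in particular `twSeededEnsembleEquivalence_false_without_allowance`: the crux with the entropy allowance
  `log 4/β` dropped is false — any proof must spend the allowance (it is load-bearing), and no allowance decaying
  faster than `e^{−8β}` can be true. (The crux's `log 4/β` sits above the floor for every `β > 0`: no kill.)

See `Cruxes/TwSeededEnsembleEquivalence/Disproof.lean` (gen 4) for the analysis these serve.
-/

namespace Summit.HubbardSuperconductivity.HubbardSuperconductivity.Theorems.TwSeededEnsembleEquivalence.Negative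

open Matrix Literature.MathematicalPhysics.QuantumLattice Literature.Probability.LatticeModels
open Summit.HubbardSuperconductivity.HubbardSuperconductivity.Theses.ThermalWedge
open scoped ComplexOrder Matrix.Norms.L2Operator

noncomputable section

/-! ### Elementary: the free mode factor carries entropy `2 log(1 + e^{−y})` -/

/-- `(1 + cosh y)/2 = e^y (1 + e^{−y})²/4`. [folklore] -/
theorem one_add_cosh_div_two_eq (y : ℝ) :
    (1 + Real.cosh y) / 2 = Real.exp y * (1 + Real.exp (-y)) ^ 2 / 4 := by
  have h : Real.exp y * Real.exp (-y) = 1 := by rw [← Real.exp_add, add_neg_cancel, Real.exp_zero]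
  rw [Real.cosh_eq]
  linear_combination (-(2 + Real.exp (-y)) / 4) * h

/-- `log((1 + cosh y)/2) = y + 2 log(1 + e^{−y}) − log 4`. [folklore] -/
theorem log_one_add_cosh_div_two_eq (y : ℝ) :
    Real.log ((1 + Real.cosh y) / 2) = y + 2 * Real.log (1 + Real.exp (-y)) - Real.log 4 := by
  rw [one_add_cosh_div_two_eq]
  have h1 : 0 < 1 + Real.exp (-y) := by positivity
  rw [Real.log_div (by positivity) (by norm_num), Real.log_mul (Real.exp_pos _).ne' (by positivity),
    Real.log_exp, Real.log_pow]
  push_cast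
  ring

/-- Monotone minorant: for `y ≤ Y`, `log((1 + cosh y)/2) ≥ y + 2 log(1 + e^{−Y}) − log 4`. [folklore] -/
theorem log_one_add_cosh_div_two_ge {y Y : ℝ} (hyY : y ≤ Y) :
    y + 2 * Real.log (1 + Real.exp (-Y)) - Real.log 4 ≤ Real.log ((1 + Real.cosh y) / 2) := by
  rw [log_one_add_cosh_div_two_eq]
  have h : Real.log (1 + Real.exp (-Y)) ≤ Real.log (1 + Real.exp (-y)) :=
    Real.log_le_log (by positivity) (by
      apply add_le_add le_rfl
      exact Real.exp_le_exp.2 (by linarith))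
  linarith

/-- The free per-mode factor in logarithm, with its entropy kept: for `β ≥ 0` and `|ξ| ≤ Ξ`,
`−βξ + β|ξ| + 2 log(1 + e^{−βΞ}) − log 4 ≤ log(e^{−βξ}(1 + cosh(β|ξ|))/2)`. [folklore] -/
theorem log_freeModeFactor_ge {β ξ Ξ : ℝ} (hβ : 0 ≤ β) (hξ : |ξ| ≤ Ξ) :
    -(β * ξ) + β * |ξ| + 2 * Real.log (1 + Real.exp (-(β * Ξ))) - Real.log 4 ≤
      Real.log (Real.exp (-(β * ξ)) * ((1 + Real.cosh (β * |ξ|)) / 2)) := by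
  have hc : 0 < (1 + Real.cosh (β * |ξ|)) / 2 := by
    have := Real.one_le_cosh (β * |ξ|); positivity
  rw [Real.log_mul (Real.exp_pos _).ne' hc.ne', Real.log_exp]
  have h := log_one_add_cosh_div_two_ge (mul_le_mul_of_nonneg_left hξ hβ)
  linarith

/-! ### The free torus: extensive thermal entropy above the ground energy -/

/-- **Free thermal entropy floor.** For `L ≥ 3`, `β ≥ 0` and a chemical potential with
`|ε_L(k) − μ| ≤ Ξ` for every momentum `k`:
`−2β Σ_k min(ε_L(k) − μ, 0) + 2L² log(1 + e^{−βΞ}) ≤ log Re Z_β(hubbardTorusWith 2 L 1 0 μ)`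
(each of the `L²` momenta contributes the four levels `0, ξ, ξ, 2ξ` of the pair `(k↑, −k↓)`, i.e. the factor
`e^{−βξ}(1 + cosh βξ)/2 · 4 = (1 + e^{−βξ})²` relative to the ground term). [folklore] -/
theorem log_partitionFn_free_torus_ge (L : ℕ) [NeZero L] (hL : 3 ≤ L) {β : ℝ} (hβ : 0 ≤ β) (μ Ξ : ℝ)
    (hΞ : ∀ k : TorusSite 2 L, |torusBand L k - μ| ≤ Ξ) :
    -(2 * β * ∑ k : TorusSite 2 L, min (torusBand L k - μ) 0) +
        2 * (L : ℝ) ^ 2 * Real.log (1 + Real.exp (-(β * Ξ))) ≤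
      Real.log (partitionFn β (hubbardTorusWith 2 L 1 0 μ)).re := by
  have hZ := partitionFn_dWaveSourceTorus_zero_re hL β μ 0
  rw [dWaveSourceTorus_zero] at hZ
  have hsimp : ∀ k : TorusSite 2 L, Real.sqrt ((torusBand L k - μ) ^ 2 + (2 * Real.sqrt 2 * 0 * dWaveGap k) ^ 2) =
      |torusBand L k - μ| := fun k => by
    rw [mul_zero, zero_mul, zero_pow two_ne_zero, add_zero, Real.sqrt_sq_eq_abs]
  simp_rw [hsimp] at hZ
  rw [hZ, card_orb_fermionTorus_two]
  have hpow : (0 : ℝ) < (2 : ℝ) ^ (2 * L ^ 2) := by positivity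
  have hfac : ∀ k : TorusSite 2 L, Real.exp (-(β * (torusBand L k - μ))) *
      ((1 + Real.cosh (β * |torusBand L k - μ|)) / 2) ≠ 0 := fun k => by
    have := Real.one_le_cosh (β * |torusBand L k - μ|); positivity
  rw [Real.log_mul hpow.ne' (Finset.prod_ne_zero_iff.2 fun k _ => hfac k),
    Real.log_prod (s := Finset.univ) (hf := fun k _ => hfac k), Real.log_pow]
  have hlo : ∑ k : TorusSite 2 L, (-(β * (torusBand L k - μ)) + β * |torusBand L k - μ| +
      2 * Real.log (1 + Real.exp (-(β * Ξ))) - Real.log 4) ≤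
      ∑ k : TorusSite 2 L, Real.log (Real.exp (-(β * (torusBand L k - μ))) *
        ((1 + Real.cosh (β * |torusBand L k - μ|)) / 2)) :=
    Finset.sum_le_sum fun k _ => log_freeModeFactor_ge hβ (hΞ k)
  have hid : ∀ k : TorusSite 2 L, -(β * (torusBand L k - μ)) + β * |torusBand L k - μ| =
      -2 * β * min (torusBand L k - μ) 0 := fun k => by
    have := neg_add_abs_eq (torusBand L k - μ)
    linear_combination β * this
  simp_rw [hid] at hlo
  rw [Finset.sum_sub_distrib, Finset.sum_add_distrib, Finset.sum_const, Finset.sum_const, Finset.card_univ,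
    card_torusSite_two, nsmul_eq_mul, nsmul_eq_mul, ← Finset.mul_sum] at hlo
  have hlog4 : Real.log 4 = 2 * Real.log 2 := by
    rw [show (4 : ℝ) = 2 ^ 2 by norm_num, Real.log_pow]; push_cast; ring
  have hcast : ((L ^ 2 : ℕ) : ℝ) = (L : ℝ) ^ 2 := by push_cast; ring
  have hcast2 : ((2 * L ^ 2 : ℕ) : ℝ) = 2 * (L : ℝ) ^ 2 := by push_cast; ring
  rw [hcast] at hlo
  rw [hcast2]
  rw [hlog4] at hlo
  linarith

/-- The same floor through the free ground energy `E₀(K⁰_μ) = 2 Σ_k min(ε_L(k) − μ, 0)` and for `|μ| ≤ 4`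
(band `[−4, 4]`, so `Ξ = 8`): `−β E₀(K⁰_μ) + 2L² log(1 + e^{−8β}) ≤ log Re Z_β(K⁰_μ)`. [folklore] -/
theorem log_partitionFn_free_torus_ge_groundEnergy (L : ℕ) [NeZero L] (hL : 3 ≤ L) {β : ℝ} (hβ : 0 ≤ β)
    {μ : ℝ} (hμ : |μ| ≤ 4) :
    -(β * (hubbardTorusWith 2 L 1 0 μ).groundEnergy) + 2 * (L : ℝ) ^ 2 * Real.log (1 + Real.exp (-(8 * β))) ≤
      Real.log (partitionFn β (hubbardTorusWith 2 L 1 0 μ)).re := by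
  have hΞ : ∀ k : TorusSite 2 L, |torusBand L k - μ| ≤ 8 := fun k => by
    have h1 := abs_torusBand_le L k
    have h2 : |torusBand L k - μ| ≤ |torusBand L k| + |μ| := abs_sub _ _
    norm_num at h1
    linarith
  have h := log_partitionFn_free_torus_ge L hL hβ μ 8 hΞ
  rw [groundEnergy_hubbardTorusWith_zero hL μ, show β * 8 = 8 * β by ring] at *
  linarith

/-! ### The seeded interacting torus: the same floor at the price `U` per site -/

/-- **Pressure floor for the seeded model.** For `L ≥ 3`, `U ≥ 0`, `g ≥ 0`, `β ≥ 0`, `|μ| ≤ 4`: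
`log Re Z_β(hubbardTorusWith 2 L 1 U μ − (g/L²)ΔᴴΔ) ≥ −β E₀(K⁰_μ) + 2L² log(1 + e^{−8β}) − βUL²`
(drop the seed `−(g/L²)ΔᴴΔ ≤ 0` by Loewner monotonicity of `log Z`, and pay the repulsion through the
Lipschitz bound `|log Z(H₁) − log Z(H₂)| ≤ β‖H₁ − H₂‖` with `‖U Σ_x n↑n↓‖ ≤ UL²`). [folklore] -/
theorem log_partitionFn_seededGC_ge (L : ℕ) [NeZero L] (hL : 3 ≤ L) {U g β μ : ℝ} (hU : 0 ≤ U)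
    (hg : 0 ≤ g) (hβ : 0 ≤ β) (hμ : |μ| ≤ 4) :
    -(β * (hubbardTorusWith 2 L 1 0 μ).groundEnergy) + 2 * (L : ℝ) ^ 2 * Real.log (1 + Real.exp (-(8 * β))) -
        β * U * (L : ℝ) ^ 2 ≤
      Real.log (partitionFn β (hubbardTorusWith 2 L 1 U μ - ((g / (L : ℝ) ^ 2 : ℝ) : ℂ) •
        ((pairField dWaveFormFactor L)ᴴ * pairField dWaveFormFactor L))).re := by
  have hLpos : (0 : ℝ) < (L : ℝ) ^ 2 := cast_sq_pos_of_neZero L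
  -- (a) drop the seed
  have hseed : Real.log (partitionFn β (hubbardTorusWith 2 L 1 U μ)).re ≤
      Real.log (partitionFn β (hubbardTorusWith 2 L 1 U μ - ((g / (L : ℝ) ^ 2 : ℝ) : ℂ) •
        ((pairField dWaveFormFactor L)ᴴ * pairField dWaveFormFactor L))).re := by
    refine log_partitionFn_le_of_posSemidef (isHermitian_seededGC L U μ g) (isHermitian_hubbardTorusWith L 1 U μ)
      hβ ?_
    rw [sub_sub_cancel]
    exact (pairField_conjTranspose_mul_self_posSemidef dWaveFormFactor L).smul
      (Complex.zero_le_real.2 (div_nonneg hg hLpos.le))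
  -- (b) bound the repulsion by `U L²`
  have hW : hubbardTorusWith 2 L 1 U μ =
      hubbardTorusWith 2 L 1 0 μ + (U : ℂ) • ∑ x : FermionTorus 2 L, numberOp x 0 * numberOp x 1 := by
    have h := hamiltonianWith_sub_hamiltonianWith (fermionTorusGraph 2 L) 1 0 U μ
    rw [sub_zero] at h
    change hubbardTorusWith 2 L 1 U μ - hubbardTorusWith 2 L 1 0 μ = _ at h
    rw [← h]; abel
  have hWnorm : ‖(U : ℂ) • ∑ x : FermionTorus 2 L,
      (numberOp x 0 * numberOp x 1 : Matrix (Finset (Orb (FermionTorus 2 L))) (Finset (Orb (FermionTorus 2 L))) ℂ)‖ ≤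
      U * (L : ℝ) ^ 2 := by
    rw [norm_smul, Complex.norm_real, Real.norm_of_nonneg hU]
    refine mul_le_mul_of_nonneg_left ?_ hU
    calc ‖∑ x : FermionTorus 2 L,
          (numberOp x 0 * numberOp x 1 : Matrix (Finset (Orb (FermionTorus 2 L))) (Finset (Orb (FermionTorus 2 L))) ℂ)‖
        ≤ ∑ x : FermionTorus 2 L,
          ‖(numberOp x 0 * numberOp x 1 : Matrix (Finset (Orb (FermionTorus 2 L))) (Finset (Orb (FermionTorus 2 L))) ℂ)‖ :=
          norm_sum_le _ _
      _ ≤ ∑ _x : FermionTorus 2 L, (1 : ℝ) := Finset.sum_le_sum fun x _ =>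
          (norm_mul_le _ _).trans (mul_le_one₀ (norm_numberOp_le_one x 0) (norm_nonneg _) (norm_numberOp_le_one x 1))
      _ = (L : ℝ) ^ 2 := by
          rw [Finset.sum_const, Finset.card_univ, card_fermionTorus, nsmul_eq_mul, mul_one]; push_cast; ring
  have hrep : Real.log (partitionFn β (hubbardTorusWith 2 L 1 0 μ)).re -
      Real.log (partitionFn β (hubbardTorusWith 2 L 1 U μ)).re ≤ β * (U * (L : ℝ) ^ 2) := by
    refine (log_partitionFn_sub_log_partitionFn_le (isHermitian_hubbardTorusWith L 1 0 μ)
      (isHermitian_hubbardTorusWith L 1 U μ) hβ).trans ?_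
    rw [hW, add_sub_cancel_left]
    exact mul_le_mul_of_nonneg_left hWnorm hβ
  -- (c) the free floor
  have hfree := log_partitionFn_free_torus_ge_groundEnergy L hL hβ hμ
  nlinarith [hfree, hrep, hseed]

/-! ### The T = 0 half on a sector and the defect floor -/

/-- **Grand-canonical ground energy below every sector** (the trivial half at `T = 0`): for a sector `K ≠ ⊥`
of `N`-particle vectors, `E₀(Hcan − μN̂) + μN ≤ minE(Hcan, K)`. [folklore] -/
theorem groundEnergy_seededGC_add_le_minEnergyOn (L : ℕ) [NeZero L] (U μ g : ℝ) {N : ℕ}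
    (K : Submodule ℂ (Fock (Orb (FermionTorus 2 L)))) (hK : K ≠ ⊥) (hKN : ∀ ψ ∈ K, IsNParticle N ψ) :
    (hubbardTorusWith 2 L 1 U μ - ((g / (L : ℝ) ^ 2 : ℝ) : ℂ) •
        ((pairField dWaveFormFactor L)ᴴ * pairField dWaveFormFactor L)).groundEnergy + μ * N ≤
      (hubbardTorus 2 L 1 U - ((g / (L : ℝ) ^ 2 : ℝ) : ℂ) •
        ((pairField dWaveFormFactor L)ᴴ * pairField dWaveFormFactor L)).minEnergyOn K := by
  obtain ⟨v, hvK, hv0⟩ := (Submodule.ne_bot_iff K).1 hK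
  obtain ⟨c, -, hc1⟩ := exists_smul_unit hv0
  refine le_csInf ⟨_, c • v, K.smul_mem c hvK, hc1, rfl⟩ ?_
  rintro E ⟨φ, hφK, hφ1, rfl⟩
  have h := groundEnergy_le_rayleigh_holds (isHermitian_seededGC L U μ g) φ hφ1
  rw [re_rayleigh_seededGC L U μ g (hKN φ hφK) hφ1] at h
  linarith

/-- **TEMPLATE H — THE DEFECT FLOOR.** For `L ≥ 3`, `U ≥ 0`, `g ≥ 0`, `β > 0`, `|μ| ≤ 4` and every sector
`K ≠ ⊥` of `N`-particle vectors:
`(2/β) log(1 + e^{−8β}) − U − 32g ≤ minE(Hcan, K)/L² + log Re Z(β, Hcan − μN̂)/(βL²) − μN/L²`.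
(Sector half at `T = 0`; `E₀` is non-decreasing in `U` and drops by `≤ 32gL²` under the seed; the free model's
thermal entropy `2 Σ_k log(1 + e^{−β|ξ_k|}) ≥ 2L² log(1 + e^{−8β})` is the floor.) [folklore] -/
theorem seeded_defect_floor (L : ℕ) [NeZero L] (hL : 3 ≤ L) {U g β μ : ℝ} (hU : 0 ≤ U) (hg : 0 ≤ g)
    (hβ : 0 < β) (hμ : |μ| ≤ 4) {N : ℕ} (K : Submodule ℂ (Fock (Orb (FermionTorus 2 L)))) (hK : K ≠ ⊥)
    (hKN : ∀ ψ ∈ K, IsNParticle N ψ) :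
    2 / β * Real.log (1 + Real.exp (-(8 * β))) - U - 32 * g ≤
      (hubbardTorus 2 L 1 U - ((g / (L : ℝ) ^ 2 : ℝ) : ℂ) •
          ((pairField dWaveFormFactor L)ᴴ * pairField dWaveFormFactor L)).minEnergyOn K / (L : ℝ) ^ 2 +
        Real.log (partitionFn β (hubbardTorusWith 2 L 1 U μ - ((g / (L : ℝ) ^ 2 : ℝ) : ℂ) •
          ((pairField dWaveFormFactor L)ᴴ * pairField dWaveFormFactor L))).re / (β * (L : ℝ) ^ 2) -
        μ * N / (L : ℝ) ^ 2 := by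
  have hLpos : (0 : ℝ) < (L : ℝ) ^ 2 := cast_sq_pos_of_neZero L
  have hβL : 0 < β * (L : ℝ) ^ 2 := mul_pos hβ hLpos
  -- T = 0 chain: minE − μN ≥ E₀(Hgc U g) ≥ E₀(Hgc 0 g) ≥ E₀(K⁰_μ) − 32 g L²
  have h1 := groundEnergy_seededGC_add_le_minEnergyOn L U μ g K hK hKN
  have h2 : (hubbardTorusWith 2 L 1 0 μ - ((g / (L : ℝ) ^ 2 : ℝ) : ℂ) •
        ((pairField dWaveFormFactor L)ᴴ * pairField dWaveFormFactor L)).groundEnergy ≤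
      (hubbardTorusWith 2 L 1 U μ - ((g / (L : ℝ) ^ 2 : ℝ) : ℂ) •
        ((pairField dWaveFormFactor L)ᴴ * pairField dWaveFormFactor L)).groundEnergy := by
    refine groundEnergy_mono_of_posSemidef_sub (isHermitian_seededGC L 0 μ g) (isHermitian_seededGC L U μ g) ?_
    rw [sub_sub_sub_cancel_right]
    have h := hamiltonianWith_sub_hamiltonianWith (fermionTorusGraph 2 L) 1 0 U μ
    rw [sub_zero] at h
    change hubbardTorusWith 2 L 1 U μ - hubbardTorusWith 2 L 1 0 μ = _ at h
    rw [h]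
    exact (posSemidef_sum_numberOp_mul_numberOp (Λ := FermionTorus 2 L)).smul (Complex.zero_le_real.2 hU)
  have h3 := groundEnergy_seededGC_le_add L 0 μ (g₀ := 0) hg
  have h30 : hubbardTorusWith 2 L 1 0 μ - ((0 / (L : ℝ) ^ 2 : ℝ) : ℂ) •
      ((pairField dWaveFormFactor L)ᴴ * pairField dWaveFormFactor L) = hubbardTorusWith 2 L 1 0 μ := by
    rw [zero_div, Complex.ofReal_zero, zero_smul, sub_zero]
  rw [h30, sub_zero] at h3
  -- thermal chain
  have h4 := log_partitionFn_seededGC_ge L hL hU hg hβ.le hμ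
  set A := (hubbardTorus 2 L 1 U - ((g / (L : ℝ) ^ 2 : ℝ) : ℂ) •
    ((pairField dWaveFormFactor L)ᴴ * pairField dWaveFormFactor L)).minEnergyOn K
  set Z := Real.log (partitionFn β (hubbardTorusWith 2 L 1 U μ - ((g / (L : ℝ) ^ 2 : ℝ) : ℂ) •
    ((pairField dWaveFormFactor L)ᴴ * pairField dWaveFormFactor L))).re
  set E := (hubbardTorusWith 2 L 1 0 μ).groundEnergy
  set ℓ := Real.log (1 + Real.exp (-(8 * β)))
  -- A − μN ≥ E − 32 g L² and Z ≥ −βE + 2L²ℓ − βUL²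
  have hA : E - 32 * g * (L : ℝ) ^ 2 ≤ A - μ * N := by linarith
  have hZ : -(β * E) + 2 * (L : ℝ) ^ 2 * ℓ - β * U * (L : ℝ) ^ 2 ≤ Z := h4
  have hZ' : -(E / (L : ℝ) ^ 2) + 2 / β * ℓ - U ≤ Z / (β * (L : ℝ) ^ 2) := by
    rw [le_div_iff₀ hβL]
    have : (-(E / (L : ℝ) ^ 2) + 2 / β * ℓ - U) * (β * (L : ℝ) ^ 2) =
        -(β * E) + 2 * (L : ℝ) ^ 2 * ℓ - β * U * (L : ℝ) ^ 2 := by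
      field_simp
    linarith
  have hA' : (E - 32 * g * (L : ℝ) ^ 2) / (L : ℝ) ^ 2 ≤ (A - μ * N) / (L : ℝ) ^ 2 :=
    div_le_div_of_nonneg_right hA hLpos.le
  have e1 : (E - 32 * g * (L : ℝ) ^ 2) / (L : ℝ) ^ 2 = E / (L : ℝ) ^ 2 - 32 * g := by
    rw [sub_div, mul_div_assoc, div_self hLpos.ne', mul_one]
  have e2 : (A - μ * N) / (L : ℝ) ^ 2 = A / (L : ℝ) ^ 2 - μ * N / (L : ℝ) ^ 2 := by rw [sub_div]
  rw [e1, e2] at hA'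
  linarith

/-- The crux's sector is a legitimate instance: `szSector (2⌊(1−δ)L²/2⌋₊) 0 ≠ ⊥` for `δ ≥ 0`
(`⌊(1−δ)L²/2⌋₊ ≤ L² = |Λ|`; a ground state of the pure model exists there). [folklore] -/
theorem szSector_floor_ne_bot (L : ℕ) [NeZero L] {δ : ℝ} (hδ : 0 ≤ δ) :
    szSector (Λ := FermionTorus 2 L) (2 * ⌊(1 - δ) * (L : ℝ) ^ 2 / 2⌋₊) 0 ≠ ⊥ := by
  have hn : ⌊(1 - δ) * (L : ℝ) ^ 2 / 2⌋₊ ≤ Fintype.card (FermionTorus 2 L) := by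
    rw [card_fermionTorus]
    have hL : (0 : ℝ) ≤ (L : ℝ) ^ 2 := sq_nonneg _
    have h1 : (1 - δ) * (L : ℝ) ^ 2 / 2 ≤ (L : ℝ) ^ 2 := by nlinarith
    have h2 : ((⌊(1 - δ) * (L : ℝ) ^ 2 / 2⌋₊ : ℕ) : ℝ) ≤ (L : ℝ) ^ 2 := by
      rcases le_or_gt 0 ((1 - δ) * (L : ℝ) ^ 2 / 2) with h | h
      · exact (Nat.floor_le h).trans h1
      · rw [Nat.floor_of_nonpos h.le]; simp
    exact_mod_cast h2
  obtain ⟨⟨ψ, hψS, hψ0, -⟩, -⟩ := szSector_groundState (fermionTorusGraph 2 L) 1 0 hn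
  rw [Submodule.ne_bot_iff]
  exact ⟨ψ, hψS, hψ0⟩

/-- **The defect floor at the crux's own sector** (`L ≥ 3`, `U, g ≥ 0`, `β > 0`, `|μ| ≤ 4`, `0 ≤ δ`), in the
crux's literal normalisation of the `μ n_L` term. -/
theorem seeded_defect_floor_crux (L : ℕ) [NeZero L] (hL : 3 ≤ L) {U g β μ δ : ℝ} (hU : 0 ≤ U) (hg : 0 ≤ g)
    (hβ : 0 < β) (hμ : |μ| ≤ 4) (hδ : 0 ≤ δ) :
    2 / β * Real.log (1 + Real.exp (-(8 * β))) - U - 32 * g ≤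
      (hubbardTorus 2 L 1 U - ((g / (L : ℝ) ^ 2 : ℝ) : ℂ) •
          ((pairField dWaveFormFactor L)ᴴ * pairField dWaveFormFactor L)).minEnergyOn
          (szSector (Λ := FermionTorus 2 L) (2 * ⌊(1 - δ) * (L : ℝ) ^ 2 / 2⌋₊) 0) / (L : ℝ) ^ 2 +
        Real.log (partitionFn β (hubbardTorusWith 2 L 1 U μ - ((g / (L : ℝ) ^ 2 : ℝ) : ℂ) •
          ((pairField dWaveFormFactor L)ᴴ * pairField dWaveFormFactor L))).re / (β * (L : ℝ) ^ 2) -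
        μ * (2 * (⌊(1 - δ) * (L : ℝ) ^ 2 / 2⌋₊ : ℝ)) / (L : ℝ) ^ 2 := by
  have h := seeded_defect_floor L hL hU hg hβ hμ (N := 2 * ⌊(1 - δ) * (L : ℝ) ^ 2 / 2⌋₊)
    (szSector (Λ := FermionTorus 2 L) (2 * ⌊(1 - δ) * (L : ℝ) ^ 2 / 2⌋₊) 0) (szSector_floor_ne_bot L hδ)
    (fun ψ hψ => ((mem_szSector_iff _ _ ψ).1 hψ).1)
  have hcast : ((2 * ⌊(1 - δ) * (L : ℝ) ^ 2 / 2⌋₊ : ℕ) : ℝ) = 2 * (⌊(1 - δ) * (L : ℝ) ^ 2 / 2⌋₊ : ℝ) := by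
    push_cast; ring
  rwa [hcast] at h

/-! ### Kill forms: allowances below the floor are refuted -/

/-- **Any allowance below the floor is refuted.** If `a(β₀) < (2/β₀) log(1 + e^{−8β₀})` at some `β₀ ≥ 1`, the
variant of `TwSeededEnsembleEquivalence` with entropy allowance `a(β)` in place of `log 4/β` is FALSE
(witness: any `δ` in the window, `β = β₀`, `U = min U₀ (c/4)`, `g = min (1/10) (c/128)`, `ε = c/4`,
`c` = the gap below the floor, `L = max L₀ 3`). [folklore] -/
theorem twSeededEnsembleEquivalence_false_of_allowance_lt (a : ℝ → ℝ) {β₀ : ℝ} (hβ₀ : 1 ≤ β₀)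
    (ha : a β₀ < 2 / β₀ * Real.log (1 + Real.exp (-(8 * β₀)))) :
    ¬ (∀ δ ∈ Set.Icc (1/10 : ℝ) (2/5 : ℝ), ∃ μ₁ μ₂ : ℝ, -4 < μ₁ ∧ μ₁ ≤ μ₂ ∧ μ₂ < 0 ∧ ∃ U₀ : ℝ, 0 < U₀ ∧
        ∀ U ∈ Set.Ioc (0 : ℝ) U₀, ∀ g ∈ Set.Ioc (0 : ℝ) (1 / 10), ∀ β : ℝ, 1 ≤ β →
          ∃ μ ∈ Set.Icc μ₁ μ₂, ∀ ε : ℝ, 0 < ε → ∃ L₀ : ℕ, ∀ (L : ℕ) [NeZero L], L₀ ≤ L →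
            (((hubbardTorus 2 L 1 U - ((g / (L : ℝ) ^ 2 : ℝ) : ℂ) •
              ((pairField dWaveFormFactor L)ᴴ * pairField dWaveFormFactor L))).minEnergyOn
                (szSector (Λ := FermionTorus 2 L) (2 * ⌊(1 - δ) * (L : ℝ) ^ 2 / 2⌋₊) 0) / (L : ℝ) ^ 2) +
              (Real.log (Matrix.partitionFn β (hubbardTorusWith 2 L 1 U μ - ((g / (L : ℝ) ^ 2 : ℝ) : ℂ) •
                ((pairField dWaveFormFactor L)ᴴ * pairField dWaveFormFactor L))).re / (β * (L : ℝ) ^ 2)) -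
              μ * ((2 * ⌊(1 - δ) * (L : ℝ) ^ 2 / 2⌋₊) : ℝ) / (L : ℝ) ^ 2 ≤ a β + ε) := by
  intro H
  set c := 2 / β₀ * Real.log (1 + Real.exp (-(8 * β₀))) - a β₀ with hc
  have hcpos : 0 < c := by rw [hc]; linarith
  have hδ : (1/10 : ℝ) ∈ Set.Icc (1/10 : ℝ) (2/5 : ℝ) := ⟨le_rfl, by norm_num⟩
  obtain ⟨μ₁, μ₂, hμ₁, hμ₁₂, hμ₂, U₀, hU₀, hU⟩ := H (1/10) hδ
  have hUm : min U₀ (c / 4) ∈ Set.Ioc (0 : ℝ) U₀ := ⟨lt_min hU₀ (by positivity), min_le_left _ _⟩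
  have hgm : min (1/10 : ℝ) (c / 128) ∈ Set.Ioc (0 : ℝ) (1 / 10) := ⟨lt_min (by norm_num) (by positivity), min_le_left _ _⟩
  obtain ⟨μ, hμm, hμ⟩ := hU _ hUm _ hgm β₀ hβ₀
  obtain ⟨L₀, hL₀⟩ := hμ (c / 4) (by positivity)
  haveI : NeZero (max L₀ 3) := ⟨by omega⟩
  have hinst := hL₀ (max L₀ 3) (le_max_left _ _)
  have hμabs : |μ| ≤ 4 := by
    rw [abs_le]; constructor <;> linarith [hμm.1, hμm.2]
  have hfloor := seeded_defect_floor_crux (max L₀ 3) (le_max_right _ _) (U := min U₀ (c / 4))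
    (g := min (1/10 : ℝ) (c / 128)) (δ := 1/10) hUm.1.le hgm.1.le (lt_of_lt_of_le one_pos hβ₀) hμabs (by norm_num)
  have hU4 : min U₀ (c / 4) ≤ c / 4 := min_le_right _ _
  have hg128 : min (1/10 : ℝ) (c / 128) ≤ c / 128 := min_le_right _ _
  change _ ≤ a β₀ + c / 4 at hinst
  linarith

/-- **The entropy allowance is load-bearing** (`_false_without_allowance`): the crux with `log 4/β` dropped
(right-hand side `ε` alone) is FALSE. Any proof of `TwSeededEnsembleEquivalence` must spend the allowance. -/
theorem twSeededEnsembleEquivalence_false_without_allowance :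
    ¬ (∀ δ ∈ Set.Icc (1/10 : ℝ) (2/5 : ℝ), ∃ μ₁ μ₂ : ℝ, -4 < μ₁ ∧ μ₁ ≤ μ₂ ∧ μ₂ < 0 ∧ ∃ U₀ : ℝ, 0 < U₀ ∧
        ∀ U ∈ Set.Ioc (0 : ℝ) U₀, ∀ g ∈ Set.Ioc (0 : ℝ) (1 / 10), ∀ β : ℝ, 1 ≤ β →
          ∃ μ ∈ Set.Icc μ₁ μ₂, ∀ ε : ℝ, 0 < ε → ∃ L₀ : ℕ, ∀ (L : ℕ) [NeZero L], L₀ ≤ L →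
            (((hubbardTorus 2 L 1 U - ((g / (L : ℝ) ^ 2 : ℝ) : ℂ) •
              ((pairField dWaveFormFactor L)ᴴ * pairField dWaveFormFactor L))).minEnergyOn
                (szSector (Λ := FermionTorus 2 L) (2 * ⌊(1 - δ) * (L : ℝ) ^ 2 / 2⌋₊) 0) / (L : ℝ) ^ 2) +
              (Real.log (Matrix.partitionFn β (hubbardTorusWith 2 L 1 U μ - ((g / (L : ℝ) ^ 2 : ℝ) : ℂ) •
                ((pairField dWaveFormFactor L)ᴴ * pairField dWaveFormFactor L))).re / (β * (L : ℝ) ^ 2)) -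
              μ * ((2 * ⌊(1 - δ) * (L : ℝ) ^ 2 / 2⌋₊) : ℝ) / (L : ℝ) ^ 2 ≤ ε) := by
  intro H
  refine twSeededEnsembleEquivalence_false_of_allowance_lt (fun _ => 0) le_rfl ?_ ?_
  · have : 0 < Real.log (1 + Real.exp (-(8 * (1 : ℝ)))) := Real.log_pos (by linarith [Real.exp_pos (-(8 * (1:ℝ)))])
    positivity
  · intro δ hδ
    obtain ⟨μ₁, μ₂, hμ₁, hμ₁₂, hμ₂, U₀, hU₀, hU⟩ := H δ hδ
    refine ⟨μ₁, μ₂, hμ₁, hμ₁₂, hμ₂, U₀, hU₀, fun U hUm g hg β hβ => ?_⟩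
    obtain ⟨μ, hμm, hμ⟩ := hU U hUm g hg β hβ
    refine ⟨μ, hμm, fun ε hε => ?_⟩
    obtain ⟨L₀, hL₀⟩ := hμ ε hε
    exact ⟨L₀, fun L _ hL => by simpa only [zero_add] using hL₀ L hL⟩

/-- **The floor sits below the crux's allowance**: `(2/β) log(1 + e^{−8β}) < log 4/β` for every `β > 0`
(`1 + e^{−8β} < 2 < 4^{1/2}`), so Template H refutes no instance of the crux itself — it calibrates it. -/
theorem defect_floor_lt_allowance {β : ℝ} (hβ : 0 < β) :
    2 / β * Real.log (1 + Real.exp (-(8 * β))) < Real.log 4 / β := by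
  have h1 : Real.exp (-(8 * β)) < 1 := by
    have := Real.exp_lt_exp.2 (show -(8 * β) < 0 by linarith)
    rwa [Real.exp_zero] at this
  have h2 : Real.log (1 + Real.exp (-(8 * β))) < Real.log 2 :=
    Real.log_lt_log (by positivity) (by linarith)
  have hlog4 : Real.log 4 = 2 * Real.log 2 := by
    rw [show (4 : ℝ) = 2 ^ 2 by norm_num, Real.log_pow]; push_cast; ring
  rw [hlog4, div_mul_eq_mul_div, div_lt_div_iff_of_pos_right hβ]
  linarith

end

end Summit.HubbardSuperconductivity.HubbardSuperconductivity.Theorems.TwSeededEnsembleEquivalence.Negative
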